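import Summits.NavierStokesRegularity.NavierStokesRegularity.Theses.TypeIQuarterGate
import Summits.NavierStokesRegularity.NavierStokesRegularity.Theorems.TypeIQuarterGateQuarterLawTypeIStubCountQuarterLaw
import HarnessLib

/-!
# `TypeIQuarterGate.CountQuarterLaw` (item stmt-NavierStokesRegularity-23971): COUNT ⇒ the quarter law
# under the sup-norm Type-I rate

**Statement (the route decl, verbatim).** For `ν, T > 0` and a maximal smooth solution `(u, p)` of the
unforced Navier–Stokes system on `ℝ³ × [0,T)`, Leray–Hopf from its rapidly decaying datum, with the
sup-norm Type-I rate at `T`: if for every `η > 0` there are `N, r₀` such that at every scale `r ≤ r₀`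
every `2r`-separated family of points whose vertex-`T` cylinders `B_r(x) × (T−r², T)` carry
`∫∫ |∇u|_F² ≥ η r` has at most `N` members, then `∫ ‖curl u(t)‖² ≤ K/√(T−t)` on `[0,T)` for some `K`.

PROOF: the by-name stub `CountQuarterLaw.stub_countQuarterLaw` of the crux skeleton `lorentz-upgrade`
(same statement): sparse-core engine (global enstrophy identity + KNSS gradient rate + Lamb-form slice
estimate + Gronwall at exponent `1/4`) fed, at the single scale `λ√(T−t)`, by the doubled balls of a
maximal separated concentrating family (COUNT bounds their number) and by the one-scale ε-regularity
smallness off them (Seregin 2014 Prop. 3.11 (i) with centre-uniform constant + CKN Prop. 1 in the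
`E`-currency, after unit-viscosity rescaling).

HONEST FRAMING: bookkeeping along a HYPOTHETICAL Type-I blow-up with a HYPOTHETICAL concentration count;
the cruxes `QuarterLawTypeI` (23726), `UniformConcentrationCountTypeI` (23970), `LorentzUpgradeTypeI`
(24108) are NOT touched and nothing about Navier–Stokes regularity or blow-up is claimed.
[cite: KochNadirashviliSereginSverak2009, §4 Prop. 4.1 (4.6)] [cite: Seregin2014, Ch. 6 §6.3 Prop. 3.11 (i)]
-/

-- the problem directory repeats the summit name (`NavierStokesRegularity/NavierStokesRegularity`)
set_option linter.dupNamespace false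

noncomputable section

namespace Summit.NavierStokesRegularity.NavierStokesRegularity.Theorems

/-- **Item stmt-NavierStokesRegularity-23971** (`TypeIQuarterGate.CountQuarterLaw`): under the sup-norm
Type-I rate, the scale-uniform ε-concentration count forces Leray's quarter rate
`∫ ‖curl u(t)‖² ≤ K/√(T−t)` on `[0,T)`. Bookkeeping along a hypothetical blow-up; nothing about
Navier–Stokes regularity or blow-up is asserted.
[cite: KochNadirashviliSereginSverak2009, §4 Prop. 4.1 (4.6)] [cite: Seregin2014, Ch. 6 §6.3 Prop. 3.11 (i)] -/
theorem typeIQuarterGate_countQuarterLaw_proof :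
    Summit.NavierStokesRegularity.NavierStokesRegularity.Theses.TypeIQuarterGate.CountQuarterLaw := by
  unfold Summit.NavierStokesRegularity.NavierStokesRegularity.Theses.TypeIQuarterGate.CountQuarterLaw
  exact CountQuarterLaw.stub_countQuarterLaw

end Summit.NavierStokesRegularity.NavierStokesRegularity.Theorems

end
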